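import Mathlib.AlgebraicGeometry.EllipticCurve.DivisionPolynomial.Basic
import HarnessLib

/-!
# The Hesse pencil at `n = 3`: the fractional-linear map from `E : y² = x³ − 27c₄x − 54c₆` to
# Fisher's `E_{λ,μ} : y² = x³ − 27𝔠₄(λ,μ)x − 54𝔠₆(λ,μ)` on `3`-torsion — the three polynomial
# identities (file F2 of the cell `b2b-bsdres` discharge of Fisher 2012 Thm. 13.2, `n = 3`;
# seat n1011-p02 gen 7, 'T-F132-3'; Mathlib only)

HONEST FRAMING (cell `b2b-bsdres`, run/shared/lean/b2b/bsd-rank1-residual/, verbatim in every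
file): the goal of the cell is to DELETE the COMBINATION-SHAPED residual classes of the
Birch–Swinnerton-Dyer formula for ALL analytic-rank `≤ 1` elliptic curves over `ℚ` — "full BSD
formula for every rank `≤ 1` curve in class `C`" assembled STRICTLY from published theorems — so
that the rank-`≤ 1` remainder becomes exactly the CONSTRUCTION-SHAPED classes, which are TYPED
(missing-input `Prop`s), NOT attempted. This is not "finishing BSD". This file: our formalisation of
a step of a published proof (pure polynomial identities); no definition, no named fact.

## Mathematics

Let `C : Y²Z = X³ − 27c₄XZ² − 54c₆Z³` and `He(C)` its Hessian; `He(C)/8 = 3XY² − 81c₄X²Z −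
486c₆XZ² − 729c₄²Z³`.  The plane cubic `P_{λ,μ} := λ·C − (μ/9)·He(C)/8` of the syzygetic (Hesse)
pencil passes through the nine flexes of `C` (= `E[3]`), has the flex `O = (0:1:0)` with tangent
line `Z' := 3λZ − μX = 0`, and the projective-linear change of coordinates
`x' = (a x + b)/(3λ − μx)`, `y' = 3𝔇·y/(3λ − μx)`, `a = 3(λ³ − 3c₄λμ² − 2c₆μ³)`,
`b = −27μ(c₄λ² + 2c₆λμ + c₄²μ²)`, `𝔇 = 𝔇(λ,μ) = λ⁴ − 6c₄λ²μ² − 8c₆λμ³ − 3c₄²μ⁴` carries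
`P_{λ,μ}` onto Fisher's Weierstrass model `E_{λ,μ} : y² = x³ − 27𝔠₄(λ,μ)x − 54𝔠₆(λ,μ)` (Proc. LMS
104 (2012) §8 and Thm. 13.2, `n = 3`; the closed forms of `𝔠₄, 𝔠₆` are the tree's
`Fisher2012.eval_hesseC4three` / `eval_hesseC6three`).  On the affine chart `Z = 1` of `C` one has
`He(C)/8 = 3x·(y² − f(x)) + Ψ₃(x)` with `Ψ₃` the `3`-division polynomial of `C`, whence the three
identities proved below BY `ring`/`linear_combination` (coefficients found with sympy, kit j139699):

* `hesse3_psi3_transport` — `(3λ − μx)⁴ · Ψ₃^{E_{λ,μ}}(x') = 81𝔇³ · Ψ₃^{E}(x)`: the map sends the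
  `3`-division abscissae of `E` to those of `E_{λ,μ}`;
* `hesse3_equation_transport` — `(3λ − μx)³ · (y'² − (x'³ − 27𝔠₄x' − 54𝔠₆)) =
  9𝔇²(3λ − μx)·(y² − (x³ − 27c₄x − 54c₆)) − 3μ𝔇²·Ψ₃^{E}(x)`: a `3`-torsion point of `E` lands ON
  `E_{λ,μ}`;
* `hesse3_den_identity` — `μ⁴·Ψ₃^{E}(x) = 243𝔇 + (μx − 3λ)·Q`: the denominator does not vanish at a
  `3`-division abscissa unless `𝔇(λ,μ) = 0` (singular member); and `hesse3_det` — `a·3λ − b·(−μ) = 9𝔇`.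

Consequences in the shape consumed by the generic transfer theorem (file F3): `hesse3_den_ne_zero`,
`hesse3_eval_Ψ₃_eq_zero`, `hesse3_equation`.

References: [Fisher2012Hessian] T. Fisher, The Hessian of a genus one curve, Proc. LMS (3) 104
(2012), §8, Thm. 13.2; [SilvermanAEC2009] III.1, Ex. 3.7 (`Ψ₃`).
-/

namespace Literature.NumberTheory.EllipticCurves.Fisher2012

open Polynomial WeierstrassCurve

variable {F : Type*} [Field F]

/-- `Ψ₃` of `y² = x³ + Ax + B`, evaluated: `3x⁴ + 6Ax² + 12Bx − A²`. [folklore] -/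
private theorem eval_Ψ₃_shortModel (A B x : F) :
    (⟨0, 0, 0, A, B⟩ : WeierstrassCurve F).Ψ₃.eval x = 3 * x ^ 4 + 6 * A * x ^ 2 + 12 * B * x - A ^ 2 := by
  simp only [WeierstrassCurve.Ψ₃, WeierstrassCurve.b₂, WeierstrassCurve.b₄, WeierstrassCurve.b₆,
    WeierstrassCurve.b₈, eval_add, eval_mul, eval_pow, eval_C, eval_X, eval_ofNat]
  ring

/-- The affine equation of `y² = x³ + Ax + B`. [folklore] -/
private theorem equation_shortModel_iff (A B x y : F) :
    (⟨0, 0, 0, A, B⟩ : WeierstrassCurve F).toAffine.Equation x y ↔ y ^ 2 = x ^ 3 + A * x + B := by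
  rw [WeierstrassCurve.Affine.equation_iff]
  change y ^ 2 + 0 * x * y + 0 * y = x ^ 3 + 0 * x ^ 2 + A * x + B ↔ _
  constructor <;> intro h <;> linear_combination h

/-! ### The three identities -/

/-- **`Ψ₃`-transport identity.**  With `x' = (a x + b)/(3λ − μx)`:
`(3λ − μx)⁴ · Ψ₃^{E_{λ,μ}}(x') = 81𝔇(λ,μ)³ · Ψ₃^{E}(x)` — stated multiplied out (no division):
for every `x`, with `N = a x + b`, `D = 3λ − μx`. [cite: Fisher2012Hessian, §8 and Thm. 13.2 (n = 3)] -/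
theorem hesse3_psi3_transport (c₄ c₆ l m x : F) :
    3 * (3 * (l ^ 3 - 3 * c₄ * l * m ^ 2 - 2 * c₆ * m ^ 3) * x
          - 27 * m * (c₄ * l ^ 2 + 2 * c₆ * l * m + c₄ ^ 2 * m ^ 2)) ^ 4
      + 6 * (-27 * (c₄ * l ^ 4 + 4 * c₆ * l ^ 3 * m + 6 * c₄ ^ 2 * l ^ 2 * m ^ 2 + 4 * c₄ * c₆ * l * m ^ 3 +
    (4 * c₆ ^ 2 - 3 * c₄ ^ 3) * m ^ 4)) *
          (3 * (l ^ 3 - 3 * c₄ * l * m ^ 2 - 2 * c₆ * m ^ 3) * x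
            - 27 * m * (c₄ * l ^ 2 + 2 * c₆ * l * m + c₄ ^ 2 * m ^ 2)) ^ 2 * (3 * l - m * x) ^ 2
      + 12 * (-54 * (c₆ * l ^ 6 + 6 * c₄ ^ 2 * l ^ 5 * m + 15 * c₄ * c₆ * l ^ 4 * m ^ 2 + 20 * c₆ ^ 2 * l ^ 3 * m ^ 3 +
    15 * c₄ ^ 2 * c₆ * l ^ 2 * m ^ 4 + (18 * c₄ ^ 4 - 12 * c₄ * c₆ ^ 2) * l * m ^ 5 +
    (9 * c₄ ^ 3 * c₆ - 8 * c₆ ^ 3) * m ^ 6)) *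
          (3 * (l ^ 3 - 3 * c₄ * l * m ^ 2 - 2 * c₆ * m ^ 3) * x
            - 27 * m * (c₄ * l ^ 2 + 2 * c₆ * l * m + c₄ ^ 2 * m ^ 2)) * (3 * l - m * x) ^ 3
      - (-27 * (c₄ * l ^ 4 + 4 * c₆ * l ^ 3 * m + 6 * c₄ ^ 2 * l ^ 2 * m ^ 2 + 4 * c₄ * c₆ * l * m ^ 3 +
    (4 * c₆ ^ 2 - 3 * c₄ ^ 3) * m ^ 4)) ^ 2 * (3 * l - m * x) ^ 4 =
    81 * (l ^ 4 - 6 * c₄ * l ^ 2 * m ^ 2 - 8 * c₆ * l * m ^ 3 - 3 * c₄ ^ 2 * m ^ 4) ^ 3 *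
      (3 * x ^ 4 + 6 * (-27 * c₄) * x ^ 2 + 12 * (-54 * c₆) * x - (-27 * c₄) ^ 2) := by
  ring

/-- **Equation-transport identity.**  With `x' = N/D`, `y' = 3𝔇y/D`, `N = a x + b`, `D = 3λ − μx`:
`(D y')²·D − (N³ + A'·N·D² + B'·D³) = 9𝔇²D·(y² − f(x)) − 3μ𝔇²·Ψ₃^{E}(x)` (multiplied by `D³`).
[cite: Fisher2012Hessian, §8 and Thm. 13.2 (n = 3)] -/
theorem hesse3_equation_transport (c₄ c₆ l m x y : F) :
    (3 * (l ^ 4 - 6 * c₄ * l ^ 2 * m ^ 2 - 8 * c₆ * l * m ^ 3 - 3 * c₄ ^ 2 * m ^ 4) * y) ^ 2 * (3 * l - m * x)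
      - ((3 * (l ^ 3 - 3 * c₄ * l * m ^ 2 - 2 * c₆ * m ^ 3) * x
            - 27 * m * (c₄ * l ^ 2 + 2 * c₆ * l * m + c₄ ^ 2 * m ^ 2)) ^ 3
          + (-27 * (c₄ * l ^ 4 + 4 * c₆ * l ^ 3 * m + 6 * c₄ ^ 2 * l ^ 2 * m ^ 2 + 4 * c₄ * c₆ * l * m ^ 3 +
    (4 * c₆ ^ 2 - 3 * c₄ ^ 3) * m ^ 4)) *
              (3 * (l ^ 3 - 3 * c₄ * l * m ^ 2 - 2 * c₆ * m ^ 3) * x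
                - 27 * m * (c₄ * l ^ 2 + 2 * c₆ * l * m + c₄ ^ 2 * m ^ 2)) * (3 * l - m * x) ^ 2
          + (-54 * (c₆ * l ^ 6 + 6 * c₄ ^ 2 * l ^ 5 * m + 15 * c₄ * c₆ * l ^ 4 * m ^ 2 + 20 * c₆ ^ 2 * l ^ 3 * m ^ 3 +
    15 * c₄ ^ 2 * c₆ * l ^ 2 * m ^ 4 + (18 * c₄ ^ 4 - 12 * c₄ * c₆ ^ 2) * l * m ^ 5 +
    (9 * c₄ ^ 3 * c₆ - 8 * c₆ ^ 3) * m ^ 6)) * (3 * l - m * x) ^ 3) =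
    9 * (l ^ 4 - 6 * c₄ * l ^ 2 * m ^ 2 - 8 * c₆ * l * m ^ 3 - 3 * c₄ ^ 2 * m ^ 4) ^ 2 * (3 * l - m * x) * (y ^ 2 - (x ^ 3 + (-27 * c₄) * x + (-54 * c₆)))
      - 3 * m * (l ^ 4 - 6 * c₄ * l ^ 2 * m ^ 2 - 8 * c₆ * l * m ^ 3 - 3 * c₄ ^ 2 * m ^ 4) ^ 2 *
        (3 * x ^ 4 + 6 * (-27 * c₄) * x ^ 2 + 12 * (-54 * c₆) * x - (-27 * c₄) ^ 2) := by
  ring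

/-- **Denominator identity**: `μ⁴Ψ₃^{E}(x) = 243𝔇(λ,μ) + (μx − 3λ)·Q(x)`.
[cite: Fisher2012Hessian, §8 (𝔇 for n = 3)] -/
theorem hesse3_den_identity (c₄ c₆ l m x : F) :
    m ^ 4 * (3 * x ^ 4 + 6 * (-27 * c₄) * x ^ 2 + 12 * (-54 * c₆) * x - (-27 * c₄) ^ 2) =
      243 * (l ^ 4 - 6 * c₄ * l ^ 2 * m ^ 2 - 8 * c₆ * l * m ^ 3 - 3 * c₄ ^ 2 * m ^ 4) + (m * x - 3 * l) *
        (-486 * c₄ * l * m ^ 2 - 162 * c₄ * m ^ 3 * x - 648 * c₆ * m ^ 3 + 81 * l ^ 3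
          + 27 * l ^ 2 * m * x + 9 * l * m ^ 2 * x ^ 2 + 3 * m ^ 3 * x ^ 3) := by
  ring

/-- **Determinant**: `a·(3λ) − b·(−μ) = 9𝔇(λ,μ)`. [cite: Fisher2012Hessian, §8 (𝔇 for n = 3)] -/
theorem hesse3_det (c₄ c₆ l m : F) :
    3 * (l ^ 3 - 3 * c₄ * l * m ^ 2 - 2 * c₆ * m ^ 3) * (3 * l) -
        (-27 * m * (c₄ * l ^ 2 + 2 * c₆ * l * m + c₄ ^ 2 * m ^ 2)) * (-m) =
      9 * (l ^ 4 - 6 * c₄ * l ^ 2 * m ^ 2 - 8 * c₆ * l * m ^ 3 - 3 * c₄ ^ 2 * m ^ 4) := by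
  ring

/-! ### Consequences in the shape used by the transfer theorem -/

/-- **The denominator `3λ − μx` does not vanish at a `3`-division abscissa of `E`** when
`𝔇(λ,μ) ≠ 0` (characteristic `0`). [cite: Fisher2012Hessian, §8 and Thm. 13.2 (n = 3)] -/
theorem hesse3_den_ne_zero [CharZero F] (c₄ c₆ l m : F) (hD : (l ^ 4 - 6 * c₄ * l ^ 2 * m ^ 2 - 8 * c₆ * l * m ^ 3 - 3 * c₄ ^ 2 * m ^ 4) ≠ 0) {x : F}
    (hx : ((⟨0, 0, 0, -27 * c₄, -54 * c₆⟩ : WeierstrassCurve F)).Ψ₃.eval x = 0) : -m * x + 3 * l ≠ 0 := by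
  intro h0
  have hid := hesse3_den_identity c₄ c₆ l m x
  rw [eval_Ψ₃_shortModel] at hx
  rw [hx, mul_zero, show m * x - 3 * l = -(-m * x + 3 * l) by ring, h0, neg_zero, zero_mul,
    add_zero] at hid
  apply hD
  have h243 : (243 : F) ≠ 0 := by norm_num
  exact (mul_eq_zero.mp hid.symm).resolve_left h243

/-- **The map sends `3`-division abscissae of `E` to `3`-division abscissae of `E_{λ,μ}`**
(`𝔇 ≠ 0`, characteristic `0`): with `a = 3(λ³ − 3c₄λμ² − 2c₆μ³)`, `b = −27μ(c₄λ² + 2c₆λμ + c₄²μ²)`,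
`d = −μ`, `e = 3λ`, `Ψ₃^{E}(x) = 0 ⟹ Ψ₃^{E_{λ,μ}}((ax + b)/(dx + e)) = 0`.
[cite: Fisher2012Hessian, Thm. 13.2 (n = 3)] -/
theorem hesse3_eval_Ψ₃_eq_zero [CharZero F] (c₄ c₆ l m a b d e : F)
    (ha : a = 3 * (l ^ 3 - 3 * c₄ * l * m ^ 2 - 2 * c₆ * m ^ 3))
    (hb : b = -27 * m * (c₄ * l ^ 2 + 2 * c₆ * l * m + c₄ ^ 2 * m ^ 2)) (hd : d = -m) (he : e = 3 * l)
    (hD : (l ^ 4 - 6 * c₄ * l ^ 2 * m ^ 2 - 8 * c₆ * l * m ^ 3 - 3 * c₄ ^ 2 * m ^ 4) ≠ 0) {x : F} (hx : ((⟨0, 0, 0, -27 * c₄, -54 * c₆⟩ : WeierstrassCurve F)).Ψ₃.eval x = 0) :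
    ((⟨0, 0, 0, -27 * (c₄ * l ^ 4 + 4 * c₆ * l ^ 3 * m + 6 * c₄ ^ 2 * l ^ 2 * m ^ 2 + 4 * c₄ * c₆ * l * m ^ 3 +
    (4 * c₆ ^ 2 - 3 * c₄ ^ 3) * m ^ 4), -54 * (c₆ * l ^ 6 + 6 * c₄ ^ 2 * l ^ 5 * m + 15 * c₄ * c₆ * l ^ 4 * m ^ 2 + 20 * c₆ ^ 2 * l ^ 3 * m ^ 3 +
    15 * c₄ ^ 2 * c₆ * l ^ 2 * m ^ 4 + (18 * c₄ ^ 4 - 12 * c₄ * c₆ ^ 2) * l * m ^ 5 +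
    (9 * c₄ ^ 3 * c₆ - 8 * c₆ ^ 3) * m ^ 6)⟩ : WeierstrassCurve F)).Ψ₃.eval ((a * x + b) / (d * x + e)) = 0 := by
  have hden : -m * x + 3 * l ≠ 0 := hesse3_den_ne_zero c₄ c₆ l m hD hx
  have hden' : 3 * l - m * x ≠ 0 := by rwa [show 3 * l - m * x = -m * x + 3 * l by ring]
  have hid := hesse3_psi3_transport c₄ c₆ l m x
  rw [eval_Ψ₃_shortModel] at hx ⊢
  rw [hx, mul_zero] at hid
  set u := (a * x + b) / (d * x + e) with hu
  have hN : 3 * (l ^ 3 - 3 * c₄ * l * m ^ 2 - 2 * c₆ * m ^ 3) * x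
      - 27 * m * (c₄ * l ^ 2 + 2 * c₆ * l * m + c₄ ^ 2 * m ^ 2) = u * (3 * l - m * x) := by
    rw [hu, ha, hb, hd, he, div_mul_eq_mul_div, eq_div_iff hden]
    ring
  rw [hN] at hid
  have key : (3 * l - m * x) ^ 4 *
      (3 * u ^ 4 + 6 * (-27 * (c₄ * l ^ 4 + 4 * c₆ * l ^ 3 * m + 6 * c₄ ^ 2 * l ^ 2 * m ^ 2 + 4 * c₄ * c₆ * l * m ^ 3 +
    (4 * c₆ ^ 2 - 3 * c₄ ^ 3) * m ^ 4)) * u ^ 2 + 12 * (-54 * (c₆ * l ^ 6 + 6 * c₄ ^ 2 * l ^ 5 * m + 15 * c₄ * c₆ * l ^ 4 * m ^ 2 + 20 * c₆ ^ 2 * l ^ 3 * m ^ 3 +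
    15 * c₄ ^ 2 * c₆ * l ^ 2 * m ^ 4 + (18 * c₄ ^ 4 - 12 * c₄ * c₆ ^ 2) * l * m ^ 5 +
    (9 * c₄ ^ 3 * c₆ - 8 * c₆ ^ 3) * m ^ 6)) * u
        - (-27 * (c₄ * l ^ 4 + 4 * c₆ * l ^ 3 * m + 6 * c₄ ^ 2 * l ^ 2 * m ^ 2 + 4 * c₄ * c₆ * l * m ^ 3 +
    (4 * c₆ ^ 2 - 3 * c₄ ^ 3) * m ^ 4)) ^ 2) = 0 := by
    linear_combination hid
  exact (mul_eq_zero.mp key).resolve_left (pow_ne_zero 4 hden')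

/-- **A `3`-torsion point of `E` lands ON `E_{λ,μ}`**: if `(x, y) ∈ E` with `Ψ₃^{E}(x) = 0` and
`𝔇(λ,μ) ≠ 0`, then `((ax + b)/(dx + e), cy/(dx + e)) ∈ E_{λ,μ}` with `c = 3𝔇(λ,μ)`
(characteristic `0`). [cite: Fisher2012Hessian, Thm. 13.2 (n = 3)] -/
theorem hesse3_equation [CharZero F] (c₄ c₆ l m a b c d e : F)
    (ha : a = 3 * (l ^ 3 - 3 * c₄ * l * m ^ 2 - 2 * c₆ * m ^ 3))
    (hb : b = -27 * m * (c₄ * l ^ 2 + 2 * c₆ * l * m + c₄ ^ 2 * m ^ 2)) (hc : c = 3 * (l ^ 4 - 6 * c₄ * l ^ 2 * m ^ 2 - 8 * c₆ * l * m ^ 3 - 3 * c₄ ^ 2 * m ^ 4))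
    (hd : d = -m) (he : e = 3 * l) (hD : (l ^ 4 - 6 * c₄ * l ^ 2 * m ^ 2 - 8 * c₆ * l * m ^ 3 - 3 * c₄ ^ 2 * m ^ 4) ≠ 0) {x y : F}
    (hxy : ((⟨0, 0, 0, -27 * c₄, -54 * c₆⟩ : WeierstrassCurve F)).toAffine.Equation x y) (hx : ((⟨0, 0, 0, -27 * c₄, -54 * c₆⟩ : WeierstrassCurve F)).Ψ₃.eval x = 0) :
    ((⟨0, 0, 0, -27 * (c₄ * l ^ 4 + 4 * c₆ * l ^ 3 * m + 6 * c₄ ^ 2 * l ^ 2 * m ^ 2 + 4 * c₄ * c₆ * l * m ^ 3 +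
    (4 * c₆ ^ 2 - 3 * c₄ ^ 3) * m ^ 4), -54 * (c₆ * l ^ 6 + 6 * c₄ ^ 2 * l ^ 5 * m + 15 * c₄ * c₆ * l ^ 4 * m ^ 2 + 20 * c₆ ^ 2 * l ^ 3 * m ^ 3 +
    15 * c₄ ^ 2 * c₆ * l ^ 2 * m ^ 4 + (18 * c₄ ^ 4 - 12 * c₄ * c₆ ^ 2) * l * m ^ 5 +
    (9 * c₄ ^ 3 * c₆ - 8 * c₆ ^ 3) * m ^ 6)⟩ : WeierstrassCurve F)).toAffine.Equation ((a * x + b) / (d * x + e))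
      (c * y / (d * x + e)) := by
  have hden : -m * x + 3 * l ≠ 0 := hesse3_den_ne_zero c₄ c₆ l m hD hx
  have hden' : 3 * l - m * x ≠ 0 := by rwa [show 3 * l - m * x = -m * x + 3 * l by ring]
  have hid := hesse3_equation_transport c₄ c₆ l m x y
  rw [equation_shortModel_iff] at hxy ⊢
  rw [eval_Ψ₃_shortModel] at hx
  rw [hx, mul_zero, sub_zero, hxy, sub_self, mul_zero] at hid
  set u := (a * x + b) / (d * x + e) with hu
  set v := c * y / (d * x + e) with hv
  have hN : 3 * (l ^ 3 - 3 * c₄ * l * m ^ 2 - 2 * c₆ * m ^ 3) * x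
      - 27 * m * (c₄ * l ^ 2 + 2 * c₆ * l * m + c₄ ^ 2 * m ^ 2) = u * (3 * l - m * x) := by
    rw [hu, ha, hb, hd, he, div_mul_eq_mul_div, eq_div_iff hden]
    ring
  have hV : 3 * (l ^ 4 - 6 * c₄ * l ^ 2 * m ^ 2 - 8 * c₆ * l * m ^ 3 - 3 * c₄ ^ 2 * m ^ 4) * y = v * (3 * l - m * x) := by
    rw [hv, hc, hd, he, div_mul_eq_mul_div, eq_div_iff hden]
    ring
  rw [hN, hV] at hid
  have key : (3 * l - m * x) ^ 3 *
      (v ^ 2 - (u ^ 3 + (-27 * (c₄ * l ^ 4 + 4 * c₆ * l ^ 3 * m + 6 * c₄ ^ 2 * l ^ 2 * m ^ 2 + 4 * c₄ * c₆ * l * m ^ 3 +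
    (4 * c₆ ^ 2 - 3 * c₄ ^ 3) * m ^ 4)) * u + (-54 * (c₆ * l ^ 6 + 6 * c₄ ^ 2 * l ^ 5 * m + 15 * c₄ * c₆ * l ^ 4 * m ^ 2 + 20 * c₆ ^ 2 * l ^ 3 * m ^ 3 +
    15 * c₄ ^ 2 * c₆ * l ^ 2 * m ^ 4 + (18 * c₄ ^ 4 - 12 * c₄ * c₆ ^ 2) * l * m ^ 5 +
    (9 * c₄ ^ 3 * c₆ - 8 * c₆ ^ 3) * m ^ 6)))) = 0 := by
    linear_combination hid
  exact sub_eq_zero.mp ((mul_eq_zero.mp key).resolve_left (pow_ne_zero 3 hden'))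

end Literature.NumberTheory.EllipticCurves.Fisher2012
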